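import Literature.Analysis.PDE.ManifoldApproxSolve
import Literature.Analysis.PDE.LinExistTools
import HarnessLib

/-!
# Exact smooth solutions of represented linear parabolic systems on a closed manifold
# (topic `Analysis/PDE`)

Layer (A2) of the programme to prove short-time existence for quasilinear strictly parabolic
systems on a closed manifold (hypothesis `hQL` of
`Literature.Geometry.Riemannian.ricciFlow_shortTime_existence_of_quasilinear`): the **linear
existence theorem** `exists_linSolution`. On a patch system `P` carrying both the representation
`hL` of the operator (layer (I'), `exists_manifoldApproxSolve`) and the `η`-closeness of the
symbols to the identity (layer (II), `linear_apriori_residual_le`), the approximate solutions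
`v_N` with residuals `E_k(cutExpr p (R_N s)) ≤ 2^{-N}` (`k + 1 ≤ N`) are Cauchy: the difference
`v_N - v_{N'}` solves the system with source `R_{N'} - R_N`, so by the a priori estimate and the
slab estimates all energies of its cut-off chart expressions are `O(2^{-min(N,N')})`
(`sup_energy_diff_le`), hence by the Sobolev sup bound all spatial word derivatives of the
`cutExpr p (v_N ·)` are uniformly Cauchy on the closed slab. The limits are smooth in space with
jointly continuous word derivatives, satisfy the equation in the sense of time derivatives within
`[0, T]` of all word derivatives (uniform limits of derivatives), hence are jointly smooth up to
`t = 0` on the inner balls by `ParabolicTower.contDiffOn_slab_of_classical`; they glue to a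
chart-slab-smooth `v` on `M` with `v(0) = 0` and `∂ₜ v = L v + Θ` on `[0, T] × M`.

Everything is proved; no named fact and no `sorry` is introduced.

## References

* L. C. Evans, *Partial Differential Equations*, 2nd ed., AMS 2010, §7.1.2–§7.1.3 (Galerkin /
  energy method: approximate solutions, energy estimates, passage to the limit, regularity).
  [Evans2010]
* L. Hörmander, *The Analysis of Linear Partial Differential Operators III*, Springer 1985,
  §17.1. [Hormander1985III]
-/

noncomputable section

open Set Function Filter Topology Metric MeasureTheory InnerProductSpace
open scoped Manifold ContDiff Topology ENNReal RealInnerProductSpace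

namespace Literature.Analysis.PDE

open Literature.Geometry.Manifold Literature.Analysis.FunctionSpaces Literature.Analysis.FluidPDE Literature.Analysis.Calculus

/-! ### Energies of differences of approximate solutions -/

namespace PatchSystemLoc

section Cauchy

variable {E : Type*} [NormedAddCommGroup E] [NormedSpace ℝ E] {H : Type*} [TopologicalSpace H]
variable {I : ModelWithCorners ℝ E H} {M : Type*} [TopologicalSpace M] [ChartedSpace H M]
  [IsManifold I ∞ M] [I.Boundaryless] [T2Space M]
variable {E' : Type*} [NormedAddCommGroup E'] [InnerProductSpace ℝ E'] [FiniteDimensional ℝ E']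
  [MeasurableSpace E'] [BorelSpace E']
variable {F' : Type*} [NormedAddCommGroup F'] [InnerProductSpace ℝ F'] [FiniteDimensional ℝ F']
variable {ι : Type*} [Fintype ι] {P : PatchSystem I M E' ι} {T : ℝ}
  {S : ι → ℝ → E' → (E' →L[ℝ] E')} {𝔟 : ι → ℝ → E' → ((E' →L[ℝ] F') →L[ℝ] F')} {𝔠 : ι → ℝ → E' → (F' →L[ℝ] F')}
  {L : ℝ → (M → F') → M → F'}

omit [IsManifold I ∞ M] [T2Space M] [MeasurableSpace E'] [BorelSpace E'] [FiniteDimensional ℝ F'] in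
/-- **A represented operator is subtractive.** [folklore] -/
theorem op_sub
    (hL : ∀ s ∈ Icc 0 T, ∀ u : M → F', (∀ q, ContDiffOn ℝ ∞ (u ∘ (P.chart q).inv) (P.chart q).target) →
      ∀ p, ∀ y ∈ (P.chart p).target, L s u ((P.chart p).inv y) = frameOp (S p s y) (𝔟 p s y) (𝔠 p s y) (u ∘ (P.chart p).inv) y)
    {s : ℝ} (hs : s ∈ Icc 0 T) {f g : M → F'} (hf : ∀ q, ContDiffOn ℝ ∞ (f ∘ (P.chart q).inv) (P.chart q).target)
    (hg : ∀ q, ContDiffOn ℝ ∞ (g ∘ (P.chart q).inv) (P.chart q).target) (x : M) :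
    L s (fun x ↦ f x - g x) x = L s f x - L s g x := by
  have hfg : ∀ q, ContDiffOn ℝ ∞ ((fun x ↦ f x - g x) ∘ (P.chart q).inv) (P.chart q).target := fun q ↦ (hf q).sub (hg q)
  have h := op_add hL hs hfg hg x
  have heq : (fun x ↦ (f x - g x) + g x) = f := funext fun x ↦ sub_add_cancel _ _
  rw [heq] at h
  exact eq_sub_of_add_eq h.symm

/-- **Energies of the difference of two approximate solutions with the same source** are
controlled by the residuals: for every order `i` there is `C_i < ∞` (depending on `P`, `T`, the
coefficient fields — not on the solutions) such that, whenever `∂ₜ v_j = L v_j + Θ - R_j`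
(`j = 1, 2`, `v_j(0) = 0`, chart-slab-smooth) and `E_i(cutExpr P q (R₂ s - R₁ s)) ≤ δ` for all
`s, q`, then `E_i(cutExpr P p (v₁ t - v₂ t)) ≤ C_i δ` for all `t, p`.
[cite: Evans2010, §7.1.2, Thm. 2] -/
theorem sup_energy_diff_le (hT : 0 < T) (i : ℕ)
    (hS : ∀ p, ContDiffOn ℝ ∞ (uncurry (S p)) (Icc 0 T ×ˢ (P.chart p).target))
    (h𝔟 : ∀ p, ContDiffOn ℝ ∞ (uncurry (𝔟 p)) (Icc 0 T ×ˢ (P.chart p).target))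
    (h𝔠 : ∀ p, ContDiffOn ℝ ∞ (uncurry (𝔠 p)) (Icc 0 T ×ˢ (P.chart p).target)) {η : ℝ} (hη : 0 ≤ η)
    (hηS : ∀ p, ∀ s ∈ Icc 0 T, ∀ y ∈ closedBall (0 : E') (4 * P.r p), ‖S p s y - 1‖ ≤ η)
    (hsmall : 16 * (Module.finrank ℝ E' : ℝ) ^ 3 * η ^ 2 ≤ 1)
    (hL : ∀ s ∈ Icc 0 T, ∀ u : M → F', (∀ q, ContDiffOn ℝ ∞ (u ∘ (P.chart q).inv) (P.chart q).target) →
      ∀ p, ∀ y ∈ (P.chart p).target, L s u ((P.chart p).inv y) = frameOp (S p s y) (𝔟 p s y) (𝔠 p s y) (u ∘ (P.chart p).inv) y) :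
    ∃ C : ℝ≥0∞, C ≠ ⊤ ∧ ∀ {Θ v₁ v₂ R₁ R₂ : ℝ → M → F'},
      (∀ q, ContDiffOn ℝ ∞ (uncurry fun s y ↦ v₁ s ((P.chart q).inv y)) (Icc 0 T ×ˢ (P.chart q).target)) →
      (∀ q, ContDiffOn ℝ ∞ (uncurry fun s y ↦ v₂ s ((P.chart q).inv y)) (Icc 0 T ×ˢ (P.chart q).target)) →
      (∀ q, ContDiffOn ℝ ∞ (uncurry fun s y ↦ R₁ s ((P.chart q).inv y)) (Icc 0 T ×ˢ (P.chart q).target)) →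
      (∀ q, ContDiffOn ℝ ∞ (uncurry fun s y ↦ R₂ s ((P.chart q).inv y)) (Icc 0 T ×ˢ (P.chart q).target)) →
      (∀ x, v₁ 0 x = 0) → (∀ x, v₂ 0 x = 0) →
      (∀ s ∈ Icc 0 T, ∀ x, derivWithin (fun s ↦ v₁ s x) (Icc 0 T) s = L s (v₁ s) x + Θ s x - R₁ s x) →
      (∀ s ∈ Icc 0 T, ∀ x, derivWithin (fun s ↦ v₂ s x) (Icc 0 T) s = L s (v₂ s) x + Θ s x - R₂ s x) →
      ∀ {δ : ℝ≥0∞}, (∀ s ∈ Icc 0 T, ∀ q, sobolevEnergy i (cutExpr P q fun x ↦ R₂ s x - R₁ s x) ≤ δ) →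
      ∀ t ∈ Icc 0 T, ∀ p, sobolevEnergy i (cutExpr P p fun x ↦ v₁ t x - v₂ t x) ≤ C * δ := by
  classical
  obtain ⟨Λ, hΛ, C, hCtop, hC⟩ := linear_apriori_residual_le P hT i hS h𝔟 h𝔠 hη hηS hsmall
  set nn : ℝ≥0∞ := (Fintype.card ι : ℝ≥0∞) with hnn
  refine ⟨ENNReal.ofReal (Real.exp (2 * Λ * T)) * ENNReal.ofReal Λ⁻¹ * C * (nn * ENNReal.ofReal T), ?_, ?_⟩
  · exact ENNReal.mul_ne_top (ENNReal.mul_ne_top (ENNReal.mul_ne_top ENNReal.ofReal_ne_top ENNReal.ofReal_ne_top) hCtop)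
      (ENNReal.mul_ne_top (ENNReal.natCast_ne_top _) ENNReal.ofReal_ne_top)
  intro Θ v₁ v₂ R₁ R₂ hv₁ hv₂ hR₁ hR₂ hv₁0 hv₂0 hid₁ hid₂ δ hδ t ht p
  -- the difference and its source
  set d : ℝ → M → F' := fun s x ↦ v₁ s x - v₂ s x with hd
  set g : ℝ → M → F' := fun s x ↦ R₂ s x - R₁ s x with hg
  have hds : ∀ q, ContDiffOn ℝ ∞ (uncurry fun s y ↦ d s ((P.chart q).inv y)) (Icc 0 T ×ˢ (P.chart q).target) :=
    fun q ↦ (hv₁ q).sub (hv₂ q)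
  have hgs : ∀ q, ContDiffOn ℝ ∞ (uncurry fun s y ↦ g s ((P.chart q).inv y)) (Icc 0 T ×ˢ (P.chart q).target) :=
    fun q ↦ (hR₂ q).sub (hR₁ q)
  have hd0 : ∀ x, d 0 x = 0 := fun x ↦ by simp [hd, hv₁0 x, hv₂0 x]
  -- the global identity of the difference
  have hidd : ∀ s ∈ Icc 0 T, ∀ x, derivWithin (fun s ↦ d s x) (Icc 0 T) s = L s (d s) x + g s x := by
    intro s hs x
    have h1 := differentiableWithinAt_time_of_charts hv₁ hs x
    have h2 := differentiableWithinAt_time_of_charts hv₂ hs x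
    have hsub : L s (d s) x = L s (v₁ s) x - L s (v₂ s) x :=
      op_sub hL hs (fun q ↦ contDiffOn_slice_of_charts (hv₁ q) hs)
        (fun q ↦ contDiffOn_slice_of_charts (hv₂ q) hs) x
    simp only [hd, hg]
    rw [derivWithin_fun_sub h1 h2, hid₁ s hs x, hid₂ s hs x, hsub]
    abel
  -- the chart identities
  have hchart : ∀ q, ∀ s ∈ Icc 0 T, ∀ y ∈ (P.chart q).target,
      timeDerivWithin (Icc 0 T) (fun s y ↦ d s ((P.chart q).inv y)) s y =
        frameOp (S q s y) (𝔟 q s y) (𝔠 q s y) (fun y ↦ d s ((P.chart q).inv y)) y + g s ((P.chart q).inv y) := by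
    intro q s hs y hy
    rw [timeDerivWithin_apply, hidd s hs, hL s hs (d s) (fun q' ↦ contDiffOn_slice_of_charts (hds q') hs) q y hy]
    rfl
  -- the a priori estimate at the weight `Λ`
  have hap := hC le_rfl hds hd0 hgs hchart t ht
  -- the slab estimate for `w_p = cutExpr p (d ·)`
  have hw : IsSmoothSpaceTimeOn (Icc 0 T) fun s ↦ cutExpr P p (d s) := isSmoothSpaceTimeOn_cutExpr P p (hds p)
  have hpt := weight_mul_sobolevEnergy_le_residual (ν := (1 : ℝ)) hT one_pos hw (isCompact_closedBall (0 : E') (3 * P.r p))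
    (fun s y hy ↦ cutExpr_family_eq_zero P p s hy) (cutExpr_family_zero P p hd0) hΛ i ht
  -- the source integrals
  have hsrc : ∀ q, ∫⁻ s in Ioo 0 t, ENNReal.ofReal (Real.exp (-2 * Λ * s)) * sobolevEnergy i (cutExpr P q (g s)) ≤
      δ * ENNReal.ofReal T := by
    intro q
    calc _ ≤ ∫⁻ _s in Ioo 0 t, δ := by
          refine setLIntegral_mono' measurableSet_Ioo fun s hs ↦ ?_
          have hs' : s ∈ Icc 0 T := ⟨hs.1.le, hs.2.le.trans ht.2⟩
          have hw1 : ENNReal.ofReal (Real.exp (-2 * Λ * s)) ≤ 1 := by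
            rw [← ENNReal.ofReal_one]
            exact ENNReal.ofReal_le_ofReal (Real.exp_le_one_iff.2 (by nlinarith [hs.1.le, hΛ.le]))
          calc _ ≤ 1 * δ := mul_le_mul' hw1 (hδ s hs' q)
            _ = δ := one_mul δ
      _ = δ * volume (Ioo (0 : ℝ) t) := setLIntegral_const _ _
      _ ≤ δ * ENNReal.ofReal T := by
          rw [Real.volume_Ioo]
          exact mul_le_mul' le_rfl (ENNReal.ofReal_le_ofReal (by linarith [ht.2]))
  -- remove the weight
  have hee : ENNReal.ofReal (Real.exp (2 * Λ * t)) * ENNReal.ofReal (Real.exp (-2 * Λ * t)) = 1 := by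
    rw [← ENNReal.ofReal_mul (Real.exp_pos _).le, ← Real.exp_add]
    norm_num
  have hXle : ENNReal.ofReal (Real.exp (2 * Λ * t)) ≤ ENNReal.ofReal (Real.exp (2 * Λ * T)) :=
    ENNReal.ofReal_le_ofReal (Real.exp_le_exp.2 (by nlinarith [ht.2, hΛ.le]))
  have heqf : (cutExpr P p fun x ↦ v₁ t x - v₂ t x) = cutExpr P p (d t) := rfl
  rw [heqf]
  calc sobolevEnergy i (cutExpr P p (d t))
      = ENNReal.ofReal (Real.exp (2 * Λ * t)) * (ENNReal.ofReal (Real.exp (-2 * Λ * t)) * sobolevEnergy i (cutExpr P p (d t))) := by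
        rw [← mul_assoc, hee, one_mul]
    _ ≤ ENNReal.ofReal (Real.exp (2 * Λ * t)) * (ENNReal.ofReal Λ⁻¹ *
          ∫⁻ s in Ioo 0 t, ENNReal.ofReal (Real.exp (-2 * Λ * s)) * sobolevEnergy i (slabResidual 1 T (fun s ↦ cutExpr P p (d s)) s)) :=
        mul_le_mul' le_rfl hpt
    _ ≤ ENNReal.ofReal (Real.exp (2 * Λ * t)) * (ENNReal.ofReal Λ⁻¹ *
          ∑ q, ∫⁻ s in Ioo 0 t, ENNReal.ofReal (Real.exp (-2 * Λ * s)) * sobolevEnergy i (slabResidual 1 T (fun s ↦ cutExpr P q (d s)) s)) :=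
        mul_le_mul' le_rfl (mul_le_mul' le_rfl (Finset.single_le_sum
          (f := fun q ↦ ∫⁻ s in Ioo 0 t, ENNReal.ofReal (Real.exp (-2 * Λ * s)) * sobolevEnergy i (slabResidual 1 T (fun s ↦ cutExpr P q (d s)) s))
          (fun _ _ ↦ bot_le) (Finset.mem_univ p)))
    _ ≤ ENNReal.ofReal (Real.exp (2 * Λ * t)) * (ENNReal.ofReal Λ⁻¹ *
          (C * ∑ q, ∫⁻ s in Ioo 0 t, ENNReal.ofReal (Real.exp (-2 * Λ * s)) * sobolevEnergy i (cutExpr P q (g s)))) :=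
        mul_le_mul' le_rfl (mul_le_mul' le_rfl hap)
    _ ≤ ENNReal.ofReal (Real.exp (2 * Λ * T)) * (ENNReal.ofReal Λ⁻¹ * (C * ∑ _q : ι, δ * ENNReal.ofReal T)) := by
        exact mul_le_mul' hXle (mul_le_mul' le_rfl (mul_le_mul' le_rfl (Finset.sum_le_sum fun q _ ↦ hsrc q)))
    _ = _ := by rw [Finset.sum_const, Finset.card_univ, nsmul_eq_mul]; ring

/-- **Frame-word derivatives of the cut-off chart expressions of a sequence of approximate
solutions with residuals `→ 0` in all energies are uniformly Cauchy on the slab**, and those of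
the residuals tend to zero uniformly. [cite: Evans2010, §7.1.2, Thm. 3] -/
theorem words_cauchy_of_approx (hT : 0 < T)
    (hS : ∀ p, ContDiffOn ℝ ∞ (uncurry (S p)) (Icc 0 T ×ˢ (P.chart p).target))
    (h𝔟 : ∀ p, ContDiffOn ℝ ∞ (uncurry (𝔟 p)) (Icc 0 T ×ˢ (P.chart p).target))
    (h𝔠 : ∀ p, ContDiffOn ℝ ∞ (uncurry (𝔠 p)) (Icc 0 T ×ˢ (P.chart p).target)) {η : ℝ} (hη : 0 ≤ η)
    (hηS : ∀ p, ∀ s ∈ Icc 0 T, ∀ y ∈ closedBall (0 : E') (4 * P.r p), ‖S p s y - 1‖ ≤ η)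
    (hsmall : 16 * (Module.finrank ℝ E' : ℝ) ^ 3 * η ^ 2 ≤ 1)
    (hL : ∀ s ∈ Icc 0 T, ∀ u : M → F', (∀ q, ContDiffOn ℝ ∞ (u ∘ (P.chart q).inv) (P.chart q).target) →
      ∀ p, ∀ y ∈ (P.chart p).target, L s u ((P.chart p).inv y) = frameOp (S p s y) (𝔟 p s y) (𝔠 p s y) (u ∘ (P.chart p).inv) y)
    {Θ : ℝ → M → F'} {vN RN : ℕ → ℝ → M → F'}
    (hvs : ∀ N q, ContDiffOn ℝ ∞ (uncurry fun s y ↦ vN N s ((P.chart q).inv y)) (Icc 0 T ×ˢ (P.chart q).target))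
    (hRs : ∀ N q, ContDiffOn ℝ ∞ (uncurry fun s y ↦ RN N s ((P.chart q).inv y)) (Icc 0 T ×ˢ (P.chart q).target))
    (hv0 : ∀ N x, vN N 0 x = 0)
    (hid : ∀ N, ∀ s ∈ Icc 0 T, ∀ x, derivWithin (fun s ↦ vN N s x) (Icc 0 T) s = L s (vN N s) x + Θ s x - RN N s x)
    (hRsmall : ∀ N k, k + 1 ≤ N → ∀ s ∈ Icc 0 T, ∀ q, sobolevEnergy k (cutExpr P q (RN N s)) ≤ ENNReal.ofReal (2⁻¹ ^ N)) (p : ι) :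
    (∀ (m : ℕ) (ε : ℝ), 0 < ε → ∃ N₀ : ℕ, ∀ N ≥ N₀, ∀ N' ≥ N₀, ∀ w : List (Fin (Module.finrank ℝ E')), w.length ≤ m →
      ∀ t ∈ Icc 0 T, ∀ y, ‖iterDirDeriv (w.map (stdOrthonormalBasis ℝ E')) (cutExpr P p (vN N t)) y -
        iterDirDeriv (w.map (stdOrthonormalBasis ℝ E')) (cutExpr P p (vN N' t)) y‖ ≤ ε) ∧
    (∀ (m : ℕ) (ε : ℝ), 0 < ε → ∃ N₀ : ℕ, ∀ N ≥ N₀, ∀ w : List (Fin (Module.finrank ℝ E')), w.length ≤ m →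
      ∀ t ∈ Icc 0 T, ∀ y, ‖iterDirDeriv (w.map (stdOrthonormalBasis ℝ E')) (cutExpr P p (RN N t)) y‖ ≤ ε) := by
  set n : ℕ := Module.finrank ℝ E' with hn
  obtain ⟨Cs, hCstop, hCs⟩ := enorm_iterDirDeriv_sq_le (E' := E') (F' := F')
  -- smoothness and supports of the cut-off expressions
  have hws : ∀ N, ∀ t ∈ Icc 0 T, ContDiff ℝ ∞ (cutExpr P p (vN N t)) := fun N t ht ↦
    (isSmoothSpaceTimeOn_cutExpr P p (hvs N p)).contDiff_slice ht
  have hwc : ∀ N t, HasCompactSupport (cutExpr P p (vN N t)) := fun N t ↦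
    HasCompactSupport.of_support_subset_isCompact (isCompact_closedBall (0 : E') (3 * P.r p)) fun y hy ↦ by
      by_contra h; exact hy (cutExpr_family_eq_zero P p t h)
  have hrs : ∀ N, ∀ t ∈ Icc 0 T, ContDiff ℝ ∞ (cutExpr P p (RN N t)) := fun N t ht ↦
    (isSmoothSpaceTimeOn_cutExpr P p (hRs N p)).contDiff_slice ht
  have hrc : ∀ N t, HasCompactSupport (cutExpr P p (RN N t)) := fun N t ↦
    HasCompactSupport.of_support_subset_isCompact (isCompact_closedBall (0 : E') (3 * P.r p)) fun y hy ↦ by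
      by_contra h; exact hy (cutExpr_family_eq_zero P p t h)
  refine ⟨fun m ε hε ↦ ?_, fun m ε hε ↦ ?_⟩
  · -- differences
    have cutExpr_sub : ∀ (p : ι) (f g : M → F'), cutExpr P p (fun x ↦ f x - g x) = fun y ↦ cutExpr P p f y - cutExpr P p g y := fun p f g ↦ by
      funext y; simp only [cutExpr_eq_smul, smul_sub]
    set i : ℕ := 2 * (n + 1) + m with hi
    obtain ⟨Ci, hCitop, hCi⟩ := sup_energy_diff_le (P := P) hT i hS h𝔟 h𝔠 hη hηS hsmall hL
    obtain ⟨N₁, hN₁⟩ := exists_const_mul_inv_two_pow_le (ENNReal.mul_ne_top hCstop hCitop) hε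
    refine ⟨max N₁ (i + 1), fun N hN N' hN' w hw t ht y ↦ ?_⟩
    have hN1 : N₁ ≤ N := (le_max_left _ _).trans hN
    have hNi : i + 1 ≤ N := (le_max_right _ _).trans hN
    have hN'i : i + 1 ≤ N' := (le_max_right _ _).trans hN'
    -- the residual hypothesis at order `i`
    have hδ : ∀ s ∈ Icc 0 T, ∀ q, sobolevEnergy i (cutExpr P q fun x ↦ RN N' s x - RN N s x) ≤ ENNReal.ofReal (4 * 2⁻¹ ^ (max N₁ (i + 1))) := by
      intro s hs q
      rw [cutExpr_sub]
      have hq1 : ContDiff ℝ i (cutExpr P q (RN N' s)) := ((isSmoothSpaceTimeOn_cutExpr P q (hRs N' q)).contDiff_slice hs).of_le (by exact_mod_cast le_top)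
      have hq2 : ContDiff ℝ i (cutExpr P q (RN N s)) := ((isSmoothSpaceTimeOn_cutExpr P q (hRs N q)).contDiff_slice hs).of_le (by exact_mod_cast le_top)
      refine (sobolevEnergy_sub_le i hq1 hq2).trans ?_
      have h1 := hRsmall N' i hN'i s hs q
      have h2 := hRsmall N i hNi s hs q
      have hp : (2⁻¹ : ℝ) ^ N ≤ 2⁻¹ ^ max N₁ (i + 1) := pow_le_pow_of_le_one (by norm_num) (by norm_num) hN
      have hp' : (2⁻¹ : ℝ) ^ N' ≤ 2⁻¹ ^ max N₁ (i + 1) := pow_le_pow_of_le_one (by norm_num) (by norm_num) hN'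
      calc 2 * sobolevEnergy i (cutExpr P q (RN N' s)) + 2 * sobolevEnergy i (cutExpr P q (RN N s))
          ≤ 2 * ENNReal.ofReal (2⁻¹ ^ max N₁ (i + 1)) + 2 * ENNReal.ofReal (2⁻¹ ^ max N₁ (i + 1)) :=
            add_le_add (mul_le_mul' le_rfl (h1.trans (ENNReal.ofReal_le_ofReal hp'))) (mul_le_mul' le_rfl (h2.trans (ENNReal.ofReal_le_ofReal hp)))
        _ = ENNReal.ofReal (4 * 2⁻¹ ^ max N₁ (i + 1)) := by
            rw [← two_mul, ← mul_assoc, ENNReal.ofReal_mul (by norm_num)]; norm_num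
    have hE := hCi (hvs N) (hvs N') (hRs N) (hRs N') (hv0 N) (hv0 N') (hid N) (hid N') hδ t ht p
    -- the sup bound
    have hdiff : ContDiff ℝ ∞ (cutExpr P p fun x ↦ vN N t x - vN N' t x) := by rw [cutExpr_sub]; exact (hws N t ht).sub (hws N' t ht)
    have hdiffc : HasCompactSupport (cutExpr P p fun x ↦ vN N t x - vN N' t x) := by rw [cutExpr_sub]; exact (hwc N t).sub (hwc N' t)
    have hsup := hCs hdiff hdiffc w y
    refine norm_le_of_enorm_sq_le hε.le ?_
    rw [← iterDirDeriv_sub_apply (hws N t ht) (hws N' t ht), ← cutExpr_sub]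
    refine hsup.trans ?_
    calc Cs * sobolevEnergy (2 * (n + 1) + w.length) (cutExpr P p fun x ↦ vN N t x - vN N' t x)
        ≤ Cs * sobolevEnergy i (cutExpr P p fun x ↦ vN N t x - vN N' t x) := mul_le_mul' le_rfl (sobolevEnergy_mono (by omega) _)
      _ ≤ Cs * (Ci * ENNReal.ofReal (4 * 2⁻¹ ^ max N₁ (i + 1))) := mul_le_mul' le_rfl hE
      _ = Cs * Ci * ENNReal.ofReal (4 * 2⁻¹ ^ max N₁ (i + 1)) := by ring
      _ ≤ ENNReal.ofReal (ε ^ 2) := hN₁ _ (le_max_left _ _)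
  · -- residuals
    set i : ℕ := 2 * (n + 1) + m with hi
    obtain ⟨N₁, hN₁⟩ := exists_const_mul_inv_two_pow_le hCstop hε
    refine ⟨max N₁ (i + 1), fun N hN w hw t ht y ↦ ?_⟩
    have hN1 : N₁ ≤ N := (le_max_left _ _).trans hN
    have hNi : i + 1 ≤ N := (le_max_right _ _).trans hN
    refine norm_le_of_enorm_sq_le hε.le ((hCs (hrs N t ht) (hrc N t) w y).trans ?_)
    have hp : (2⁻¹ : ℝ) ^ N ≤ 4 * 2⁻¹ ^ N := le_mul_of_one_le_left (by positivity) (by norm_num)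
    calc Cs * sobolevEnergy (2 * (n + 1) + w.length) (cutExpr P p (RN N t))
        ≤ Cs * sobolevEnergy i (cutExpr P p (RN N t)) := mul_le_mul' le_rfl (sobolevEnergy_mono (by omega) _)
      _ ≤ Cs * ENNReal.ofReal (4 * 2⁻¹ ^ N) := mul_le_mul' le_rfl ((hRsmall N i hNi t ht p).trans (ENNReal.ofReal_le_ofReal hp))
      _ ≤ ENNReal.ofReal (ε ^ 2) := hN₁ N hN1

/-! ### The linear existence theorem -/

/-- **Exact smooth solutions of represented linear parabolic systems on a closed manifold.**
On a patch system carrying the representation `hL` of the operator with coefficient data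
symmetric, coercive and of small oscillation at top order, and with symbols `η`-close to the
identity on the charts (`16 n³ η² ≤ 1`), every chart-slab-smooth source `Θ` admits a
chart-slab-smooth `v` with `v(0) = 0` and `∂ₜ v = L v + Θ` on `[0, T] × M` (time derivative within
`[0, T]`). [cite: Evans2010, §7.1.2, Thm. 3; Hormander1985III, §17.1] -/
theorem exists_linSolution [Nontrivial E'] (hT : 0 < T)
    (hS : ∀ p, ContDiffOn ℝ ∞ (uncurry (S p)) (Icc 0 T ×ˢ (P.chart p).target))
    (h𝔟 : ∀ p, ContDiffOn ℝ ∞ (uncurry (𝔟 p)) (Icc 0 T ×ˢ (P.chart p).target))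
    (h𝔠 : ∀ p, ContDiffOn ℝ ∞ (uncurry (𝔠 p)) (Icc 0 T ×ˢ (P.chart p).target))
    (hL : ∀ s ∈ Icc 0 T, ∀ u : M → F', (∀ q, ContDiffOn ℝ ∞ (u ∘ (P.chart q).inv) (P.chart q).target) →
      ∀ p, ∀ y ∈ (P.chart p).target, L s u ((P.chart p).inv y) = frameOp (S p s y) (𝔟 p s y) (𝔠 p s y) (u ∘ (P.chart p).inv) y)
    (hsym : ∀ p, ∀ y ∈ closedBall (0 : E') (4 * P.r p), ContinuousLinearMap.adjoint (S p 0 y) = S p 0 y)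
    {ν₀ : ℝ} (hν₀ : 0 < ν₀) (hcoer : ∀ p, ∀ y ∈ closedBall (0 : E') (4 * P.r p), ∀ ξ : E', ν₀ * ‖ξ‖ ^ 2 ≤ ⟪S p 0 y ξ, ξ⟫)
    {εo : ℝ} (hosc : ∀ p, ∀ s ∈ Icc 0 T, ∀ y ∈ closedBall (0 : E') (4 * P.r p), ‖S p s y - S p 0 y‖ ≤ εo)
    (hεo : 2 * Real.sqrt (3840 * (Module.finrank ℝ E' : ℝ) ^ 3 *
      (10 * Real.sqrt (Module.finrank ℝ E') + 1) ^ (2 * Module.finrank ℝ E') * (Module.finrank ℝ E').factorial) * εo ≤ min 1 ν₀)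
    {η : ℝ} (hη : 0 ≤ η) (hηS : ∀ p, ∀ s ∈ Icc 0 T, ∀ y ∈ closedBall (0 : E') (4 * P.r p), ‖S p s y - 1‖ ≤ η)
    (hsmall : 16 * (Module.finrank ℝ E' : ℝ) ^ 3 * η ^ 2 ≤ 1) {Θ : ℝ → M → F'}
    (hΘ : ∀ q, ContDiffOn ℝ ∞ (uncurry fun s y ↦ Θ s ((P.chart q).inv y)) (Icc 0 T ×ˢ (P.chart q).target)) :
    ∃ v : ℝ → M → F',
      (∀ q, ContDiffOn ℝ ∞ (uncurry fun s y ↦ v s ((P.chart q).inv y)) (Icc 0 T ×ˢ (P.chart q).target)) ∧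
      (∀ x, v 0 x = 0) ∧
      (∀ s ∈ Icc 0 T, ∀ x, derivWithin (fun s ↦ v s x) (Icc 0 T) s = L s (v s) x + Θ s x) := by
  classical
  haveI : CompleteSpace F' := FiniteDimensional.complete ℝ F'
  have hU := uniqueDiffOn_Icc hT
  /- ## (1) the approximate solutions -/
  have happ := fun N : ℕ ↦ exists_manifoldApproxSolve (P := P) hT hS h𝔟 h𝔠 hL hsym hν₀ hcoer hosc hεo N hΘ
    (ε := (2⁻¹ : ℝ) ^ N) (by positivity)
  choose vN RN hvs hRs hv0 hid hRsmall using happ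
  /- ## (2) the cut-off chart expressions and their limits -/
  set f : ι → ℕ → ℝ → E' → F' := fun p N t ↦ cutExpr P p (vN N t) with hf
  have hfs : ∀ p N, IsSmoothSpaceTimeOn (Icc 0 T) (f p N) := fun p N ↦ isSmoothSpaceTimeOn_cutExpr P p (hvs N p)
  have hCR := fun p ↦ words_cauchy_of_approx (P := P) hT hS h𝔟 h𝔠 hη hηS hsmall hL hvs hRs hv0 hid hRsmall p
  have hlimits := fun p ↦ exists_slab_limit_of_words_cauchy hT (hfs p) (hCR p).1
  choose W hWs hWu hWc hWlim using hlimits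
  /- ## (3) smallness of `f p N - W p` in all frame words -/
  have hsm : ∀ p (m : ℕ) (ε : ℝ), 0 < ε → ∃ N₀ : ℕ, ∀ N ≥ N₀, ∀ w : List (Fin (Module.finrank ℝ E')), w.length ≤ m →
      ∀ t ∈ Icc 0 T, ∀ y, ‖iterDirDeriv (w.map (stdOrthonormalBasis ℝ E')) (f p N t) y -
        iterDirDeriv (w.map (stdOrthonormalBasis ℝ E')) (W p t) y‖ ≤ ε := by
    intro p m ε hε
    obtain ⟨N₀, hN₀⟩ := (hCR p).1 m ε hε
    refine ⟨N₀, fun N hN w hw t ht y ↦ ?_⟩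
    have hlim : Tendsto (fun N' ↦ iterDirDeriv (w.map (stdOrthonormalBasis ℝ E')) (f p N t) y -
        iterDirDeriv (w.map (stdOrthonormalBasis ℝ E')) (f p N' t) y) atTop
        (𝓝 (iterDirDeriv (w.map (stdOrthonormalBasis ℝ E')) (f p N t) y - iterDirDeriv (w.map (stdOrthonormalBasis ℝ E')) (W p t) y)) :=
      tendsto_const_nhds.sub ((hWu p _).tendsto_at (mk_mem_prod ht (mem_univ y)))
    refine le_of_tendsto hlim.norm ?_
    filter_upwards [Filter.eventually_ge_atTop N₀] with N' hN'
    exact hN₀ N hN N' hN' w hw t ht y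
  /- ## (4) the equation near the inner ball `ball 0 (2 rₚ)` -/
  have heq : ∀ p N, ∀ s ∈ Icc 0 T, ∀ x ∈ ball (0 : E') (2 * P.r p), timeDerivWithin (Icc 0 T) (f p N) s =ᶠ[𝓝 x]
      fun y ↦ frameOp (symbC P p S s y) (firstC P p 𝔟 s y) (zeroC P p 𝔠 s y) (f p N s) y + cutExpr P p (Θ s) y - cutExpr P p (RN N s) y := by
    intro p N s hs x hx
    filter_upwards [isOpen_ball.mem_nhds hx] with y hy
    have hy2 : y ∈ closedBall (0 : E') (2 * P.r p) := ball_subset_closedBall hy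
    have hyt : y ∈ (P.chart p).target := P.ball_subset_target p (by norm_num) hy
    have hcut1 : P.cut p y = 1 := (P.cut p).one_of_mem_closedBall (by rwa [PatchSystem.cut_rIn])
    have hysupp : y ∈ tsupport (P.cut p) := by
      rw [ContDiffBump.tsupport_eq, PatchSystem.cut_rOut]
      exact closedBall_subset_closedBall (by linarith [P.r_pos p]) hy2
    -- left-hand side
    rw [timeDerivWithin_cutExpr P p (hvs N p) hs y, hcut1, one_smul, timeDerivWithin_apply, hid N s hs,
      hL s hs (vN N s) (fun q ↦ contDiffOn_slice_of_charts (hvs N q) hs) p y hyt]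
    -- right-hand side
    rw [symbC_eq_of_mem p s hysupp, firstC_eq_of_mem p s hysupp, zeroC_eq_of_mem p s hysupp, cutExpr_of_mem P _ hyt,
      cutExpr_of_mem P _ hyt, hcut1, one_smul, one_smul]
    have hloc : (vN N s ∘ (P.chart p).inv) =ᶠ[𝓝 y] f p N s := by
      filter_upwards [isOpen_ball.mem_nhds hy] with y' hy'
      have hy't : y' ∈ (P.chart p).target := P.ball_subset_target p (by norm_num) hy'
      have hc1 : P.cut p y' = 1 := (P.cut p).one_of_mem_closedBall (by rw [PatchSystem.cut_rIn]; exact ball_subset_closedBall hy')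
      simp only [hf, Function.comp_apply, cutExpr_of_mem P _ hy't, hc1, one_smul]
    rw [frameOp_congr_of_eventuallyEq _ _ _ hloc]
  /- ## (5) joint smoothness of the limits on the inner balls -/
  have hSc : ∀ p, IsSmoothSpaceTimeOn (Icc 0 T) (symbC P p S) := fun p ↦ isSmoothSpaceTimeOn_symbC p (hS p)
  have h𝔟c : ∀ p, IsSmoothSpaceTimeOn (Icc 0 T) (firstC P p 𝔟) := fun p ↦ isSmoothSpaceTimeOn_firstC p (h𝔟 p)
  have h𝔠c : ∀ p, IsSmoothSpaceTimeOn (Icc 0 T) (zeroC P p 𝔠) := fun p ↦ isSmoothSpaceTimeOn_zeroC p (h𝔠 p)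
  have hΘc : ∀ p, IsSmoothSpaceTimeOn (Icc 0 T) fun s ↦ cutExpr P p (Θ s) := fun p ↦ isSmoothSpaceTimeOn_cutExpr P p (hΘ p)
  have hrc : ∀ p N, IsSmoothSpaceTimeOn (Icc 0 T) fun s ↦ cutExpr P p (RN N s) := fun p N ↦ isSmoothSpaceTimeOn_cutExpr P p (hRs N p)
  have hwd : ∀ p (β : List E'), ∀ t ∈ Icc 0 T, ∀ x ∈ ball (0 : E') (2 * P.r p),
      HasDerivWithinAt (fun s ↦ iterDirDeriv β (W p s) x) (iterDirDeriv β (fun y ↦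
        frameOp (symbC P p S t y) (firstC P p 𝔟 t y) (zeroC P p 𝔠 t y) (W p t) y + cutExpr P p (Θ t) y) x) (Icc 0 T) t :=
    fun p β t ht x hx ↦ hasDerivWithinAt_words_of_limit hT (hSc p) (h𝔟c p) (h𝔠c p)
      (fun s y hy ↦ symbC_eq_one p s hy) (fun s y hy ↦ firstC_eq_zero p s hy) (fun s y hy ↦ zeroC_eq_zero p s hy) (hΘc p)
      (hfs p) (hrc p) (heq p) (hWs p) (hWu p) (hsm p) (hCR p).2 β ht hx
  have hWjoint : ∀ p, ContDiffOn ℝ ∞ (uncurry (W p)) (Icc 0 T ×ˢ ball (0 : E') (2 * P.r p)) := fun p ↦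
    ParabolicTower.contDiffOn_slab_of_classical hT (hWs p) (hWc p) (hSc p) (h𝔟c p) (h𝔠c p) (hΘc p) (hwd p) isOpen_ball
  /- ## (6) the limit on `M` -/
  have hvW : ∀ p x, x ∈ (P.chart p).source → (P.chart p).map x ∈ closedBall (0 : E') (2 * P.r p) → ∀ t ∈ Icc 0 T,
      Tendsto (fun N ↦ vN N t x) atTop (𝓝 (W p t ((P.chart p).map x))) := by
    intro p x hx hmx t ht
    have hc1 : P.cut p ((P.chart p).map x) = 1 := (P.cut p).one_of_mem_closedBall (by rwa [PatchSystem.cut_rIn])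
    have heqN : ∀ N, vN N t x = f p N t ((P.chart p).map x) := fun N ↦ (cutExpr_map_of_cut_eq_one P (vN N t) hx hc1).symm
    simp only [heqN]
    exact hWlim p t ht _
  choose pc hpc using P.cover
  set v : ℝ → M → F' := fun t x ↦ W (pc x) t ((P.chart (pc x)).map x) with hv
  have hvlim : ∀ x, ∀ t ∈ Icc 0 T, Tendsto (fun N ↦ vN N t x) atTop (𝓝 (v t x)) := fun x t ht ↦
    hvW (pc x) x (hpc x).1 ((ball_subset_ball (by linarith [P.r_pos (pc x)])).trans ball_subset_closedBall (hpc x).2) t ht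
  have hvchart : ∀ p x, x ∈ (P.chart p).source → (P.chart p).map x ∈ closedBall (0 : E') (2 * P.r p) → ∀ t ∈ Icc 0 T,
      v t x = W p t ((P.chart p).map x) := fun p x hx hmx t ht ↦
    tendsto_nhds_unique (hvlim x t ht) (hvW p x hx hmx t ht)
  -- `v ∘ inv_p = W p` on the inner ball
  have hvinv : ∀ p, ∀ t ∈ Icc 0 T, ∀ y ∈ ball (0 : E') (2 * P.r p), v t ((P.chart p).inv y) = W p t y := by
    intro p t ht y hy
    have hyt : y ∈ (P.chart p).target := P.ball_subset_target p (by norm_num) hy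
    have h := hvchart p ((P.chart p).inv y) ((P.chart p).inv_mem_source hyt)
      (by rw [(P.chart p).map_inv hyt]; exact ball_subset_closedBall hy) t ht
    rwa [(P.chart p).map_inv hyt] at h
  /- ## (7) chart-slab smoothness of `v` -/
  have hvsm : ∀ q, ContDiffOn ℝ ∞ (uncurry fun s y ↦ v s ((P.chart q).inv y)) (Icc 0 T ×ˢ (P.chart q).target) := by
    intro q z hz
    obtain ⟨t, y⟩ := z
    have ht : t ∈ Icc 0 T := (mem_prod.1 hz).1
    have hy : y ∈ (P.chart q).target := (mem_prod.1 hz).2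
    set x : M := (P.chart q).inv y with hx
    set p := pc x with hp
    -- the open set where the cover chart of `x` is usable
    set O : Set E' := (P.chart q).target ∩ (P.chart q).inv ⁻¹' ((P.chart p).source ∩ (P.chart p).map ⁻¹' ball (0 : E') (2 * P.r p)) with hO
    have hOo : IsOpen O := (P.chart q).continuousOn_inv.isOpen_inter_preimage (P.chart q).isOpen_target
      ((P.chart p).isOpen_source_inter_preimage isOpen_ball)
    have hyO : y ∈ O := ⟨hy, (hpc x).1, (ball_subset_ball (by linarith [P.r_pos p])) (hpc x).2⟩
    -- on `[0, T] × O` the expression is `W p ∘ transition`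
    have hτ : ContDiffOn ℝ ∞ ((P.chart q).transition (P.chart p)) O :=
      ((P.chart q).contDiffOn_transition (P.chart p)).mono fun y' hy' ↦ ((P.chart q).mem_overlap_iff (P.chart p)).2 ⟨hy'.1, hy'.2.1⟩
    have hcomp : ContDiffOn ℝ ∞ (fun z : ℝ × E' ↦ uncurry (W p) (z.1, (P.chart q).transition (P.chart p) z.2)) (Icc 0 T ×ˢ O) := by
      refine (hWjoint p).comp (contDiffOn_fst.prodMk (hτ.comp contDiffOn_snd fun z hz ↦ (mem_prod.1 hz).2)) fun z hz ↦ ?_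
      exact mk_mem_prod (mem_prod.1 hz).1 (by rw [FramedChart.transition_apply]; exact (mem_prod.1 hz).2.2.2)
    have hcongr : ∀ z ∈ Icc 0 T ×ˢ O, (uncurry fun s y ↦ v s ((P.chart q).inv y)) z = uncurry (W p) (z.1, (P.chart q).transition (P.chart p) z.2) := by
      intro z hz
      obtain ⟨s, y'⟩ := z
      have hs : s ∈ Icc 0 T := (mem_prod.1 hz).1
      have hy' : y' ∈ O := (mem_prod.1 hz).2
      simp only [uncurry, FramedChart.transition_apply]
      exact hvchart p _ hy'.2.1 (ball_subset_closedBall hy'.2.2) s hs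
    have h1 : ContDiffWithinAt ℝ ∞ (uncurry fun s y ↦ v s ((P.chart q).inv y)) (Icc 0 T ×ˢ O) (t, y) :=
      (hcomp.congr hcongr) (t, y) (mk_mem_prod ht hyO)
    exact h1.mono_of_mem_nhdsWithin (by
      refine mem_nhdsWithin.2 ⟨univ ×ˢ O, isOpen_univ.prod hOo, mk_mem_prod (mem_univ _) hyO, ?_⟩
      rintro ⟨s, y'⟩ ⟨h1, h2⟩
      exact mk_mem_prod (mem_prod.1 h2).1 (mem_prod.1 h1).2)
  refine ⟨v, hvsm, fun x ↦ ?_, fun t ht x ↦ ?_⟩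
  · /- ## (8) the initial value -/
    have h0 : (0 : ℝ) ∈ Icc 0 T := ⟨le_rfl, hT.le⟩
    have h := hvlim x 0 h0
    simp only [hv0] at h
    exact tendsto_nhds_unique (hvlim x 0 h0) (by simp only [hv0]; exact tendsto_const_nhds)
  · /- ## (9) the equation -/
    set p := pc x with hp
    set y : E' := (P.chart p).map x with hy
    have hxs : x ∈ (P.chart p).source := (hpc x).1
    have hyb : y ∈ ball (0 : E') (2 * P.r p) := (ball_subset_ball (by linarith [P.r_pos p])) (hpc x).2
    have hyt : y ∈ (P.chart p).target := P.ball_subset_target p (by norm_num) hyb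
    have hysupp : y ∈ tsupport (P.cut p) := by
      rw [ContDiffBump.tsupport_eq, PatchSystem.cut_rOut]
      exact closedBall_subset_closedBall (by linarith [P.r_pos p]) (ball_subset_closedBall hyb)
    -- the time derivative of `v(·, x) = W p (·, y)`
    have hfun : (fun s ↦ v s x) = fun s ↦ W p s y := rfl
    have hd := (hwd p [] t ht y hyb).derivWithin (hU t ht)
    simp only [iterDirDeriv_nil] at hd
    rw [hfun, hd, symbC_eq_of_mem p t hysupp, firstC_eq_of_mem p t hysupp, zeroC_eq_of_mem p t hysupp, cutExpr_of_mem P _ hyt,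
      (P.cut p).one_of_mem_closedBall (show y ∈ closedBall (0 : E') (P.cut p).rIn by rw [PatchSystem.cut_rIn]; exact ball_subset_closedBall hyb),
      one_smul, (P.chart p).inv_map hxs]
    -- the operator term
    have hloc : W p t =ᶠ[𝓝 y] (v t ∘ (P.chart p).inv) := by
      filter_upwards [isOpen_ball.mem_nhds hyb] with y' hy'
      exact (hvinv p t ht y' hy').symm
    rw [frameOp_congr_of_eventuallyEq _ _ _ hloc, ← hL t ht (v t) (fun q ↦ contDiffOn_slice_of_charts (hvsm q) ht) p y hyt,
      (P.chart p).inv_map hxs]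

end Cauchy

end PatchSystemLoc

end Literature.Analysis.PDE
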